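import Summits.CriticalPhenomena.PercolationContinuityZ3.Theorems.PercNearOneGluingNoHeavyLowerTailSunflowerSeriesEval

/-!
# `NoHeavyLowerTail` (crux stmt-CriticalPhenomena-4575), abstract sunflower cubic: EVALUATING POWER-SERIES IDENTITIES AT A
# REAL POINT — Part 2: the geometric series `(1 - ∑_{a∈B} X a)⁻¹` and the chord inequality

Support file (seat `prim-ineq-prove-1` gen 46; `--supports stmt-CriticalPhenomena-4575`).  Continues `…SunflowerSeriesEval`.
Memo: run/shared/lean/prim/prim-ineq-prove-1/FINDING-PAR-prove1-g46.md §2 (iv).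
* `coeff_inv_one_sub_nonneg` (nonnegativity of the coefficients of `(1 - φ)⁻¹`), `inv_one_sub_eq` (the recursion
  `u⁻¹ = 1 + (∑ X a) u⁻¹`), `sum_Iic_term_inv_le` (partial sums over lower sets are `≤ (1 - ∑ x a)⁻¹`),
  **`absConv_inv_one_sub`**, **`ev_inv_one_sub`** (`ev ((1 - ∑_{a∈B} X a)⁻¹) = (1 - ∑_{a∈B} x a)⁻¹` for `x ≥ 0`,
  `∑_{a∈B} x a < 1`);
* **`tsum_pow_mul_le_chord`**: for `c, w ≥ 0` with `∑ c w < ∞`, `q ↦ ∑' c · q^n · w` lies below its chord on `[0,1]`.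
-/

namespace Summit.CriticalPhenomena.PercolationContinuityZ3.Theorems.SunflowerPartition

namespace SeriesEval

open MvPowerSeries Finset

variable {ι : Type*} [Fintype ι] [DecidableEq ι] {x : ι → ℝ}

/-! ## The geometric series `(1 - ∑_{a∈B} X a)⁻¹` -/

/-- The coefficients of `(1 - φ)⁻¹` are nonnegative when `φ ≥ 0` has no constant term (copy of the Part-A lemma, to keep
this file independent). [this work] -/
theorem coeff_inv_one_sub_nonneg {φ : MvPowerSeries ι ℚ} (h0 : constantCoeff φ = 0) (hφ : ∀ n, 0 ≤ coeff n φ) (n : ι →₀ ℕ) :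
    0 ≤ coeff n (1 - φ)⁻¹ := by
  have hc : constantCoeff (1 - φ) = 1 := by rw [map_sub, map_one, h0, sub_zero]
  induction n using WellFoundedLT.induction with
  | ind n ih =>
    rw [coeff_inv]
    split_ifs with hn
    · rw [hc]; norm_num
    · rw [hc, inv_one, neg_one_mul, ← sum_neg_distrib]
      refine sum_nonneg fun x hx => ?_
      split_ifs with hx2
      · have hx1 : x.1 ≠ 0 := by
          intro h1
          have := Finset.HasAntidiagonal.mem_antidiagonal.mp hx
          rw [h1, zero_add] at this
          exact (ne_of_lt hx2) this
        have : coeff x.1 (1 - φ) = -coeff x.1 φ := by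
          rw [map_sub, coeff_one, if_neg hx1, zero_sub]
        rw [this, neg_mul, neg_neg]
        exact mul_nonneg (hφ x.1) (ih x.2 hx2)
      · simp

omit [Fintype ι] [DecidableEq ι] in
/-- The recursion `c_β = [β = 0] + ∑_{b ∈ B, β_b ≥ 1} c_{β - e_b}` for the coefficients of `(1 - ∑_{a∈B} X a)⁻¹`,
in the form `u⁻¹ = 1 + (∑_{a ∈ B} X a) * u⁻¹`. [this work] -/
theorem inv_one_sub_eq (B : Finset ι) :
    (1 - ∑ a ∈ B, X a : MvPowerSeries ι ℚ)⁻¹ = 1 + (∑ a ∈ B, X a) * (1 - ∑ a ∈ B, X a : MvPowerSeries ι ℚ)⁻¹ := by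
  have hc : constantCoeff (1 - ∑ a ∈ B, X a : MvPowerSeries ι ℚ) ≠ 0 := by
    rw [map_sub, map_one, map_sum, Finset.sum_eq_zero fun a _ => constantCoeff_X a]; norm_num
  have h := MvPowerSeries.mul_inv_cancel _ hc
  linear_combination h

/-- Partial sums of the geometric series over a lower set are bounded by `(1 - ∑_{a∈B} x a)⁻¹`. [this work] -/
theorem sum_Iic_term_inv_le (hx : ∀ i, 0 ≤ x i) (B : Finset ι) (hB : ∑ a ∈ B, x a < 1) (N : ι →₀ ℕ) :
    ∑ β ∈ Finset.Iic N, term x (1 - ∑ a ∈ B, X a : MvPowerSeries ι ℚ)⁻¹ β ≤ (1 - ∑ a ∈ B, x a)⁻¹ := by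
  set u : MvPowerSeries ι ℚ := (1 - ∑ a ∈ B, X a)⁻¹ with hu
  have hc0 : constantCoeff (∑ a ∈ B, X a : MvPowerSeries ι ℚ) = 0 := by
    rw [map_sum, Finset.sum_eq_zero fun a _ => constantCoeff_X a]
  have hcX : ∀ n, 0 ≤ coeff n (∑ a ∈ B, X a : MvPowerSeries ι ℚ) := fun n => by
    rw [map_sum]; exact sum_nonneg fun a _ => by rw [coeff_X]; split_ifs <;> norm_num
  have hcu : ∀ β, 0 ≤ coeff β u := coeff_inv_one_sub_nonneg hc0 hcX
  have hterm : ∀ β, 0 ≤ term x u β := fun β => mul_nonneg (by exact_mod_cast hcu β) (mono_nonneg hx β)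
  set S := ∑ β ∈ Finset.Iic N, term x u β with hS
  -- key estimate: S ≤ 1 + (∑ x a) * S
  have key : S ≤ 1 + (∑ a ∈ B, x a) * S := by
    have hcoef : ∀ β, coeff β u = (if β = 0 then 1 else 0) + ∑ a ∈ B, (if Finsupp.single a 1 ≤ β then
        coeff (β - Finsupp.single a 1) u else 0) := by
      intro β
      conv_lhs => rw [hu, inv_one_sub_eq B, ← hu]
      rw [map_add, coeff_one, sum_mul, map_sum]
      congr 1
      refine sum_congr rfl fun a _ => ?_
      rw [X_def, coeff_monomial_mul]
      split_ifs <;> simp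
    have hS' : S = ∑ β ∈ Finset.Iic N, ((if β = 0 then (1:ℝ) else 0) * mono x β
        + ∑ a ∈ B, (if Finsupp.single a 1 ≤ β then ((coeff (β - Finsupp.single a 1) u : ℚ) : ℝ) * mono x β else 0)) := by
      refine sum_congr rfl fun β _ => ?_
      rw [term, hcoef β, Rat.cast_add, Rat.cast_sum, add_mul, sum_mul]
      congr 1
      · split_ifs <;> simp
      · refine sum_congr rfl fun a _ => ?_
        split_ifs <;> simp
    have h1 : ∑ β ∈ Finset.Iic N, (if β = 0 then (1:ℝ) else 0) * mono x β ≤ 1 := by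
      rw [← Finset.sum_filter_add_sum_filter_not _ (fun β => β = 0)]
      have hA : ∑ β ∈ (Finset.Iic N).filter (fun β => β = 0), (if β = 0 then (1:ℝ) else 0) * mono x β ≤ 1 := by
        by_cases h0 : (0 : ι →₀ ℕ) ∈ Finset.Iic N
        · rw [Finset.filter_eq' _ (0 : ι →₀ ℕ), if_pos h0, sum_singleton, if_pos rfl, mono_zero]; norm_num
        · rw [Finset.filter_eq' _ (0 : ι →₀ ℕ), if_neg h0, sum_empty]; norm_num
      have hB' : ∑ β ∈ (Finset.Iic N).filter (fun β => ¬ β = 0), (if β = 0 then (1:ℝ) else 0) * mono x β = 0 :=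
        sum_eq_zero fun β hβ => by rw [if_neg (mem_filter.mp hβ).2, zero_mul]
      linarith
    have h2 : ∑ β ∈ Finset.Iic N, ∑ a ∈ B, (if Finsupp.single a 1 ≤ β then
        ((coeff (β - Finsupp.single a 1) u : ℚ) : ℝ) * mono x β else 0) ≤ (∑ a ∈ B, x a) * S := by
      rw [sum_comm, sum_mul]
      refine sum_le_sum fun a _ => ?_
      -- reindex β = γ + e_a
      have : ∑ β ∈ Finset.Iic N, (if Finsupp.single a 1 ≤ β then ((coeff (β - Finsupp.single a 1) u : ℚ) : ℝ) * mono x β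
          else 0) = ∑ β ∈ (Finset.Iic N).filter (fun β => Finsupp.single a 1 ≤ β),
            ((coeff (β - Finsupp.single a 1) u : ℚ) : ℝ) * mono x β := by
        rw [sum_filter]
      rw [this]
      have hinj : Set.InjOn (fun γ : ι →₀ ℕ => γ + Finsupp.single a 1) ↑(Finset.Iic N) :=
        fun γ _ γ' _ h => add_right_cancel h
      calc ∑ β ∈ (Finset.Iic N).filter (fun β => Finsupp.single a 1 ≤ β),
            ((coeff (β - Finsupp.single a 1) u : ℚ) : ℝ) * mono x β
          ≤ ∑ β ∈ (Finset.Iic N).image (fun γ => γ + Finsupp.single a 1),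
            ((coeff (β - Finsupp.single a 1) u : ℚ) : ℝ) * mono x β := by
            refine sum_le_sum_of_subset_of_nonneg ?_ fun β _ _ =>
              mul_nonneg (by exact_mod_cast hcu _) (mono_nonneg hx β)
            intro β hβ
            obtain ⟨hβN, hle⟩ := mem_filter.mp hβ
            refine mem_image.mpr ⟨β - Finsupp.single a 1, ?_, tsub_add_cancel_of_le hle⟩
            exact Finset.mem_Iic.mpr ((tsub_le_self).trans (Finset.mem_Iic.mp hβN))
        _ = ∑ γ ∈ Finset.Iic N, ((coeff γ u : ℚ) : ℝ) * mono x (γ + Finsupp.single a 1) := by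
            rw [sum_image hinj]
            refine sum_congr rfl fun γ _ => by rw [add_tsub_cancel_right]
        _ = x a * S := by
            rw [hS, mul_sum]
            refine sum_congr rfl fun γ _ => ?_
            rw [mono_add, mono_single, term]; ring
    calc S = _ := hS'
      _ = _ := sum_add_distrib
      _ ≤ 1 + (∑ a ∈ B, x a) * S := add_le_add h1 h2
  have hlt : 0 < 1 - ∑ a ∈ B, x a := by linarith
  have hS0 : 0 ≤ S := sum_nonneg fun β _ => hterm β
  rw [inv_eq_one_div, le_div_iff₀ hlt]
  nlinarith [key, hS0]

/-- The geometric series `(1 - ∑_{a∈B} X a)⁻¹` converges absolutely at `x ≥ 0` with `∑_{a∈B} x a < 1`. [this work] -/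
theorem absConv_inv_one_sub (hx : ∀ i, 0 ≤ x i) (B : Finset ι) (hB : ∑ a ∈ B, x a < 1) :
    AbsConv x (1 - ∑ a ∈ B, X a : MvPowerSeries ι ℚ)⁻¹ := by
  set u : MvPowerSeries ι ℚ := (1 - ∑ a ∈ B, X a)⁻¹ with hu
  have hc0 : constantCoeff (∑ a ∈ B, X a : MvPowerSeries ι ℚ) = 0 := by
    rw [map_sum, Finset.sum_eq_zero fun a _ => constantCoeff_X a]
  have hcX : ∀ n, 0 ≤ coeff n (∑ a ∈ B, X a : MvPowerSeries ι ℚ) := fun n => by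
    rw [map_sum]; exact sum_nonneg fun a _ => by rw [coeff_X]; split_ifs <;> norm_num
  have hcu : ∀ β, 0 ≤ coeff β u := coeff_inv_one_sub_nonneg hc0 hcX
  have habs : ∀ β, |((coeff β u : ℚ) : ℝ)| * mono x β = term x u β := fun β => by
    rw [term, abs_of_nonneg (by exact_mod_cast hcu β)]
  have hterm : ∀ β, 0 ≤ term x u β := fun β => mul_nonneg (by exact_mod_cast hcu β) (mono_nonneg hx β)
  refine summable_of_sum_le (c := (1 - ∑ a ∈ B, x a)⁻¹) (fun β => by rw [habs]; exact hterm β) fun s => ?_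
  simp_rw [habs]
  calc ∑ β ∈ s, term x u β ≤ ∑ β ∈ Finset.Iic (s.sup id), term x u β := by
        refine sum_le_sum_of_subset_of_nonneg (fun β hβ => Finset.mem_Iic.mpr (Finset.le_sup (f := id) hβ))
          fun β _ _ => hterm β
    _ ≤ (1 - ∑ a ∈ B, x a)⁻¹ := sum_Iic_term_inv_le hx B hB _

/-- The value of the geometric series: `ev ((1 - ∑_{a∈B} X a)⁻¹) = (1 - ∑_{a∈B} x a)⁻¹`. [this work] -/
theorem ev_inv_one_sub (hx : ∀ i, 0 ≤ x i) (B : Finset ι) (hB : ∑ a ∈ B, x a < 1) :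
    ev x (1 - ∑ a ∈ B, X a : MvPowerSeries ι ℚ)⁻¹ = (1 - ∑ a ∈ B, x a)⁻¹ := by
  have hc : constantCoeff (1 - ∑ a ∈ B, X a : MvPowerSeries ι ℚ) ≠ 0 := by
    rw [map_sub, map_one, map_sum, Finset.sum_eq_zero fun a _ => constantCoeff_X a]; norm_num
  have h1 : ev x ((1 - ∑ a ∈ B, X a : MvPowerSeries ι ℚ) * (1 - ∑ a ∈ B, X a : MvPowerSeries ι ℚ)⁻¹) = 1 := by
    rw [MvPowerSeries.mul_inv_cancel _ hc, ev_one]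
  rw [ev_mul hx (absConv_one_sub_sum_X hx B) (absConv_inv_one_sub hx B hB), ev_one_sub_sum_X hx B] at h1
  have hne : (1 - ∑ a ∈ B, x a) ≠ 0 := by linarith
  field_simp
  linarith [h1]

/-! ## The chord inequality for nonnegative coefficient families -/

omit [Fintype ι] [DecidableEq ι] in
/-- For `c ≥ 0`, `w ≥ 0` summable and exponents `n`, the function `q ↦ ∑' β, c β · q ^ (n β) · w β` lies below its
chord on `[0,1]`:  value at `q` ≤ `q ·` value at `1` `+ (1 - q) ·` value at `0`. [this work] -/
theorem tsum_pow_mul_le_chord {κ : Type*} (c w : κ → ℝ) (n : κ → ℕ) (hc : ∀ k, 0 ≤ c k) (hw : ∀ k, 0 ≤ w k)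
    (hs : Summable fun k => c k * w k) (q : ℝ) (hq0 : 0 ≤ q) (hq1 : q ≤ 1) :
    ∑' k, c k * q ^ n k * w k ≤ q * ∑' k, c k * w k + (1 - q) * ∑' k, c k * (0 : ℝ) ^ n k * w k := by
  have hsq : ∀ r : ℝ, 0 ≤ r → r ≤ 1 → Summable fun k => c k * r ^ n k * w k := by
    intro r hr0 hr1
    refine Summable.of_nonneg_of_le (fun k => mul_nonneg (mul_nonneg (hc k) (pow_nonneg hr0 _)) (hw k))
      (fun k => ?_) hs
    calc c k * r ^ n k * w k ≤ c k * 1 * w k := by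
          gcongr
          · exact hw k
          · exact hc k
          · exact pow_le_one₀ hr0 hr1
      _ = c k * w k := by ring
  rw [← tsum_mul_left, ← tsum_mul_left, ← ((hs.mul_left q)).tsum_add ((hsq 0 le_rfl zero_le_one).mul_left (1 - q))]
  refine (hsq q hq0 hq1).tsum_le_tsum (fun k => ?_) ((hs.mul_left q).add ((hsq 0 le_rfl zero_le_one).mul_left _))
  -- termwise: q^n ≤ q · 1 + (1 - q) · 0^n
  have key : q ^ n k ≤ q + (1 - q) * (0 : ℝ) ^ n k := by
    rcases Nat.eq_zero_or_pos (n k) with h | h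
    · rw [h, pow_zero, pow_zero]; linarith
    · rw [zero_pow (Nat.pos_iff_ne_zero.mp h), mul_zero, add_zero]
      calc q ^ n k ≤ q ^ 1 := pow_le_pow_of_le_one hq0 hq1 h
        _ = q := pow_one q
  have hcw : 0 ≤ c k * w k := mul_nonneg (hc k) (hw k)
  nlinarith [key, hcw, hc k, hw k]

end SeriesEval

end Summit.CriticalPhenomena.PercolationContinuityZ3.Theorems.SunflowerPartition
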